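import Summits.AtomisticToContinuum.Crystallization.Theorems.ThreeConeCertificateSlackRigidityLawRigidity
import Summits.AtomisticToContinuum.Crystallization.Theorems.ThreeConeCertificateSlackRigidityOfPalmRigidity
import Summits.AtomisticToContinuum.Crystallization.Theorems.ThreeConeCertificateSlackRigidityPalmReduction
import Summits.AtomisticToContinuum.Crystallization.Theorems.ThreeConeCertificateSlackRigidityPinsMinimisers
import Literature.MathematicalPhysics.StatisticalMechanics.CrystallizationLocalLimit
import HarnessLib

/-!
# `PalmRigidity` (item 9224) `⟺` `SlackRigidity` (crux 11960) `∧` "an optimal relaxed hcp lies in the box"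

Lead c14, line `ekeland-surgery-parity` of the crux `ThreeConeCertificate.SlackRigidity`
(stmt-AtomisticToContinuum-11960).  The line closes the crux modulo the single stub
`stub_palmRigidity : PalmRigidity` (= item stmt-AtomisticToContinuum-9224).  This file computes EXACTLY
how much stronger that stub is than the crux:

**`palmRigidity_iff_slackRigidity_and_hcpOptimal`.**
`PalmRigidity ↔ SlackRigidity ∧ ∃ a h ∈ [1/2, 2]² (a, h ≠ 0), e(hcp a h) = ⨅_Q e(Q)`.

* (→) is the landed closure `EkelandSurgeryParityClosure.slackRigidity_of_palmRigidity` (p122051) and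
  `EkelandSurgeryParityReduction.exists_optimal_of_palmRigidity` (lead c1).
* (←) is new: if `P₀` witnesses the crux and `hcp(a, h)` is a periodic minimiser, then `hcp(a, h)` is
  matched to `P₀` at the root at every scale (`SlackRigidityPinsMinimisers.siteMatched_of_rigidFor`,
  lead c12), hence is EXACTLY a rotation of `P₀` (`eq_image_of_forall_locallyMatches`; more generally
  every periodic minimiser seen from any site is exactly a rotation of `P₀`,
  `exists_points_sub_eq_of_rigidFor`, and the witness is exactly vertex-transitive,
  `witness_vertexTransitive`), hence is itself
  a witness (`rigidFor_of_points_eq`: the matching predicate only sees the template up to linear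
  isometry); and a witness `Q` makes every minimising point-stationary rooted hard-core law a.s.
  `count|(A '' Q.points)` (`SlackRigidityLawRigidity.ae_good_of_rigidFor` +
  `eq_image_of_forall_locallyMatches`), which for `Q = hcp(a, h)` is the conclusion of `PalmRigidity`.

So item 9224 = (crux 11960) ∧ (the periodic Lennard-Jones minimum is ATTAINED, by a relaxed hcp with
parameters in `[1/2, 2]²`) — the second conjunct is item 11961 `KeplerBound` sharpened to name the
minimiser.  All `[folklore]`.
-/

noncomputable section

open scoped BigOperators Topology
open MeasureTheory Filter Set
open Literature.Probability.Process
open Literature.MathematicalPhysics.StatisticalMechanics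
open Summit.AtomisticToContinuum.Crystallization.Theses.ThreeConeCertificate (SlackRigidity)
open Summit.AtomisticToContinuum.Crystallization.Theses.PalmUnimodularRigidity (PalmRigidity)

namespace Summit.AtomisticToContinuum.Crystallization.Theorems.SlackRigidityLawPalmSplit

open Summit.AtomisticToContinuum.Crystallization.Theorems.SlackRigidityNegative
  (E3 Good badCount RigidFor slackRigidity_iff)
open Summit.AtomisticToContinuum.Crystallization.Theorems.ChargedEnergyGapNegative
  (bddBelow_energyPerParticle_lennardJones)

/-! ## The matching predicate sees the template only up to linear isometry -/

/-- `Good` is invariant under replacing the template by a congruent one. [folklore] -/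
theorem good_iff_of_points_eq {P₀ Q : PeriodicConfiguration 3} (B : E3 →ₗᵢ[ℝ] E3)
    (hQ : Q.points = B '' P₀.points) {R ε : ℝ} {N : ℕ} (x : Fin N → E3) (i : Fin N) :
    Good P₀ R ε x i ↔ Good Q R ε x i := by
  set Be : E3 ≃ₗᵢ[ℝ] E3 := B.toLinearIsometryEquiv rfl with hBe
  have hBe' : ∀ p, Be p = B p := fun p => LinearIsometry.coe_toLinearIsometryEquiv B rfl ▸ rfl
  constructor
  · rintro ⟨A, h1, h2⟩
    refine ⟨A.comp Be.symm.toLinearIsometry, fun q hq hqR => ?_, fun j hj => ?_⟩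
    · rw [hQ] at hq
      obtain ⟨p, hp, rfl⟩ := hq
      obtain ⟨j, hj⟩ := h1 p hp (by simpa using hqR)
      refine ⟨j, ?_⟩
      simpa [LinearIsometry.comp_apply, ← hBe' p] using hj
    · obtain ⟨p, hp, hd⟩ := h2 j hj
      refine ⟨B p, by rw [hQ]; exact ⟨p, hp, rfl⟩, ?_⟩
      simpa [LinearIsometry.comp_apply, ← hBe' p] using hd
  · rintro ⟨A, h1, h2⟩
    refine ⟨A.comp B, fun p hp hpR => ?_, fun j hj => ?_⟩
    · obtain ⟨j, hj⟩ := h1 (B p) (by rw [hQ]; exact ⟨p, hp, rfl⟩) (by simpa using hpR)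
      exact ⟨j, by simpa [LinearIsometry.comp_apply] using hj⟩
    · obtain ⟨q, hq, hd⟩ := h2 j hj
      rw [hQ] at hq
      obtain ⟨p, hp, rfl⟩ := hq
      exact ⟨p, hp, by simpa [LinearIsometry.comp_apply] using hd⟩

/-- **`RigidFor` transfers along exact congruence of the templates.** [folklore] -/
theorem rigidFor_of_points_eq {P₀ Q : PeriodicConfiguration 3} (B : E3 →ₗᵢ[ℝ] E3)
    (hQ : Q.points = B '' P₀.points) (h : RigidFor P₀) : RigidFor Q := by
  intro R ε hR hε x hx hex
  have h' := h R ε hR hε x hx hex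
  have hbc : ∀ N, badCount Q R ε (x N) = badCount P₀ R ε (x N) := fun N => by
    unfold badCount
    exact Nat.card_congr (Equiv.subtypeEquivRight fun i => not_congr (good_iff_of_points_eq B hQ (x N) i).symm)
  unfold SlackRigidityNegative.BadFractionVanishes at h' ⊢
  simp_rw [hbc]
  exact h'

/-! ## An optimal relaxed hcp is itself a witness of the crux -/

/-- The origin is a point of the relaxed hcp configuration. [folklore] -/
theorem zero_mem_hcpPoints {a h : ℝ} (ha : a ≠ 0) (hh : h ≠ 0) :
    (0 : E3) ∈ (hcpPeriodicConfiguration ha hh).points := by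
  rw [hcpPeriodicConfiguration_points]
  exact ⟨0, 0, 0, by simp [barlowPos]⟩

/-- **Under a witness `P₀` of the crux, every periodic minimiser seen from any of its sites is
EXACTLY a rotation of `P₀`**: `Q.points - s = B '' P₀.points` (the exact form of lead c12's
`siteMatched_of_rigidFor`, which matches `Q ∩ B_R(s)` to `s + A(P₀.points)` at every `(R, ε)`;
upgrade by `eq_image_of_forall_locallyMatches`, the translate being uniformly separated).
[folklore] -/
theorem exists_points_sub_eq_of_rigidFor {P₀ : PeriodicConfiguration 3} (hP₀ : RigidFor P₀)
    {Q : PeriodicConfiguration 3}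
    (hQ : ∀ Q' : PeriodicConfiguration 3, Q.energyPerParticle lennardJones ≤ Q'.energyPerParticle lennardJones)
    {s : E3} (hs : s ∈ Q.points) :
    ∃ B : E3 →ₗᵢ[ℝ] E3, (fun q : E3 => q - s) '' Q.points = B '' P₀.points := by
  obtain ⟨ρ, hρ, hsep⟩ := Q.exists_pos_le_dist
  have hsep' : ∀ x ∈ (fun q : E3 => q - s) '' Q.points, ∀ y ∈ (fun q : E3 => q - s) '' Q.points,
      x ≠ y → ρ ≤ dist x y := by
    rintro _ ⟨x, hx, rfl⟩ _ ⟨y, hy, rfl⟩ hne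
    rw [dist_sub_right]
    exact hsep x hx y hy fun hxy => hne (by rw [hxy])
  refine SlackRigidityLawCongruence.eq_image_of_forall_locallyMatches P₀ _ ρ hρ hsep'
    fun R ε hR hε => ?_
  obtain ⟨A, h1, h2⟩ := SlackRigidityPinsMinimisers.siteMatched_of_rigidFor hP₀ hQ hs hR hε
  refine ⟨A, fun p hp hpR => ?_, ?_⟩
  · obtain ⟨p', hp', rfl⟩ := hp
    obtain ⟨q, hq, hd⟩ := h1 p' hp' (by simpa using hpR)
    exact ⟨q - s, ⟨q, hq, rfl⟩, by rwa [dist_sub_eq_dist_add]⟩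
  · rintro _ ⟨q, hq, rfl⟩ hqR
    rw [← dist_eq_norm] at hqR
    obtain ⟨p, hp, hd⟩ := h2 q hq hqR
    exact ⟨A p, ⟨p, hp, rfl⟩, by rwa [dist_sub_eq_dist_add]⟩

/-- **Under a witness `P₀` of the crux, every periodic minimiser containing the origin is EXACTLY
a rotation of `P₀`.** [folklore] -/
theorem exists_points_eq_of_rigidFor {P₀ : PeriodicConfiguration 3} (hP₀ : RigidFor P₀)
    {Q : PeriodicConfiguration 3}
    (hQ : ∀ Q' : PeriodicConfiguration 3, Q.energyPerParticle lennardJones ≤ Q'.energyPerParticle lennardJones)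
    (h0 : (0 : E3) ∈ Q.points) :
    ∃ B : E3 →ₗᵢ[ℝ] E3, Q.points = B '' P₀.points := by
  obtain ⟨B, hB⟩ := exists_points_sub_eq_of_rigidFor hP₀ hQ h0
  refine ⟨B, ?_⟩
  rw [← hB]
  ext q
  simp

/-- **A witness of the crux is EXACTLY vertex-transitive** (exact form of the refuters'
`rigidFor_vertexTransitive`): seen from any of its sites it is a rotation of itself. [folklore] -/
theorem witness_vertexTransitive {P₀ : PeriodicConfiguration 3} (hP₀ : RigidFor P₀) {s : E3}
    (hs : s ∈ P₀.points) :
    ∃ B : E3 →ₗᵢ[ℝ] E3, (fun q : E3 => q - s) '' P₀.points = B '' P₀.points :=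
  exists_points_sub_eq_of_rigidFor hP₀ (SlackRigidityPinsMinimisers.energyPerParticle_le_of_rigidFor hP₀) hs

/-- **An optimal relaxed hcp is a witness of the crux** whenever the crux has any witness.
[folklore] -/
theorem rigidFor_hcp_of_rigidFor {P₀ : PeriodicConfiguration 3} (hP₀ : RigidFor P₀) {a h : ℝ}
    (ha : a ≠ 0) (hh : h ≠ 0)
    (hopt : (hcpPeriodicConfiguration ha hh).energyPerParticle lennardJones =
      ⨅ Q : PeriodicConfiguration 3, Q.energyPerParticle lennardJones) :
    RigidFor (hcpPeriodicConfiguration ha hh) := by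
  have hmin : ∀ Q' : PeriodicConfiguration 3,
      (hcpPeriodicConfiguration ha hh).energyPerParticle lennardJones ≤ Q'.energyPerParticle lennardJones :=
    fun Q' => by rw [hopt]; exact ciInf_le bddBelow_energyPerParticle_lennardJones Q'
  obtain ⟨B, hB⟩ := exists_points_eq_of_rigidFor hP₀ hmin (zero_mem_hcpPoints ha hh)
  exact rigidFor_of_points_eq B hB hP₀

/-! ## The split -/

/-- **(←) `SlackRigidity` with an optimal relaxed hcp in the box implies `PalmRigidity`.**
[folklore] -/
theorem palmRigidity_of_slackRigidity_of_hcpOptimal (hS : SlackRigidity)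
    (hH : ∃ a h : ℝ, ∃ ha : a ≠ 0, ∃ hh : h ≠ 0, 1 / 2 ≤ a ∧ a ≤ 2 ∧ 1 / 2 ≤ h ∧ h ≤ 2 ∧
      (hcpPeriodicConfiguration ha hh).energyPerParticle lennardJones =
        (⨅ Q : PeriodicConfiguration 3, Q.energyPerParticle lennardJones)) :
    PalmRigidity := by
  obtain ⟨P₀, hP₀⟩ := slackRigidity_iff.1 hS
  obtain ⟨a, h, ha, hh, h1, h2, h3, h4, hopt⟩ := hH
  have hQ := rigidFor_hcp_of_rigidFor hP₀ ha hh hopt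
  intro δ hδ P hP hcore hstat hE
  have hcore' : ∀ᵐ μ ∂P, IsRootedHardCore δ μ := hcore
  have hstat' : IsPointStationaryLaw P := hstat
  have hE' : (∫ μ, rootEnergy lennardJones μ ∂P) ≤
      (⨅ Q : PeriodicConfiguration 3, Q.energyPerParticle lennardJones) := hE
  have hall : ∀ᵐ μ ∂P, ∀ n : ℕ, ∃ A : E3 →ₗᵢ[ℝ] E3, LocallyMatches ((n : ℝ) + 1) (1 / ((n : ℝ) + 1))
      (atoms μ) (A '' (hcpPeriodicConfiguration ha hh).points) :=
    ae_all_iff.2 fun n => SlackRigidityLawRigidity.ae_good_of_rigidFor hQ hδ P hcore' hstat' hE'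
      (by positivity) (by positivity)
  filter_upwards [hall, hcore'] with μ hμ hhc
  obtain ⟨S, hS0, hsep, rfl⟩ := hhc
  rw [atoms_count_restrict] at hμ
  obtain ⟨A, hA⟩ := SlackRigidityLawCongruence.eq_image_of_forall_locallyMatches
    (hcpPeriodicConfiguration ha hh) S δ hδ hsep fun R ε hR hε => by
      obtain ⟨n, hn⟩ := exists_nat_ge (max R (1 / ε))
      obtain ⟨A, hA⟩ := hμ n
      refine ⟨A, hA.mono ?_ ?_⟩
      · exact (le_max_left _ _).trans (hn.trans (by linarith))
      · have h1' : 1 / ε ≤ (n : ℝ) + 1 := (le_max_right _ _).trans (hn.trans (by linarith))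
        rw [div_le_iff₀ hε] at h1'
        rw [div_le_iff₀ (by positivity)]
        linarith
  refine ⟨a, h, ha, hh, h1, h2, h3, h4, A.toLinearIsometryEquiv rfl, hopt, ?_⟩
  rw [hA, hcpPeriodicConfiguration_points, LinearIsometry.coe_toLinearIsometryEquiv]

/-- **Registered stub `palmRigidity_iff_slackRigidity_and_hcpOptimal`** — item 9224 `PalmRigidity`
is EXACTLY the crux `SlackRigidity` together with "the periodic Lennard-Jones minimum `⨅_Q e(Q)` is
attained by a relaxed hcp with parameters `(a, h) ∈ [1/2, 2]²`". [folklore] -/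
theorem palmRigidity_iff_slackRigidity_and_hcpOptimal : PalmRigidity ↔ SlackRigidity ∧ ∃ a h : ℝ, ∃ ha : a ≠ 0, ∃ hh : h ≠ 0, 1 / 2 ≤ a ∧ a ≤ 2 ∧ 1 / 2 ≤ h ∧ h ≤ 2 ∧ (hcpPeriodicConfiguration ha hh).energyPerParticle lennardJones = (⨅ Q : PeriodicConfiguration 3, Q.energyPerParticle lennardJones) :=
  ⟨fun hP => ⟨EkelandSurgeryParityClosure.slackRigidity_of_palmRigidity hP,
    EkelandSurgeryParityReduction.exists_optimal_of_palmRigidity hP⟩,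
    fun h => palmRigidity_of_slackRigidity_of_hcpOptimal h.1 h.2⟩

end Summit.AtomisticToContinuum.Crystallization.Theorems.SlackRigidityLawPalmSplit

end
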